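import Literature.Probability.LatticeModels.DobrushinShlosmanSuperSolution
import Literature.Probability.LatticeModels.DobrushinShlosmanInfiniteVolume
import HarnessLib

/-!
# The Dobrushin–Shlosman window comparison under the per-window received sum, in INFINITE volume: two
# functionals (with defects), and geometric decay along a profile

Topic `Literature/Probability/LatticeModels`; theorems only. The infinite-volume wrapper of
`DobrushinShlosmanSuperSolution.lean` (Föllmer 1988 Ch. I (2.7)–(2.11) in the window setting of Dobrushin–Shlosman
1985), written exactly like `abs_sub_le_of_window` of `DobrushinShlosmanInfiniteVolume.lean` (the same reduction to
the finite cell type `↥Λ` with the exterior frozen — followed line by line), but calling the super-solution theorem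
`abs_sub_le_superSolution` instead of the three-zone contraction:

* `abs_sub_le_of_window_superSolution` — specification `γ` on an arbitrary index set `V` with window data (site weight
  `0 ≤ r ≤ R`, windows `win c ∋ c` inside locality sets `nbhd c`, array `K ≥ 0` supported in `nbhd c` with (H1)
  `hcontract`, locality `hloc`) and the PER-WINDOW received sum `Σ_{y ∈ nbhd c} K c y x ≤ γ₀ < 1` (`x ∈ win c`); a finite
  `Λ`; `E₁` monotone-normalised on bounded measurable `Λ`-local observables and invariant under the window kernels of the
  USABLE centres (`c ∈ Λ`, `nbhd c ⊆ Λ`, `P c`); `E₂` monotone-normalised and ALMOST invariant there, with DEFECT array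
  `κ ≥ 0`: `|E₂ (γ_{win c} G) − E₂ G| ≤ Σ_{x ∈ win c} κ c x δ x` for site-Lipschitz `δ`; and a nonnegative SUPER-SOLUTION
  `d : V → ℝ`: (S1) `Σ_{y ∈ nbhd c} K c y x d y + κ c x ≤ d x` for usable `c` and `x ∈ win c`, (S2) `R ≤ d x` at every
  `x ∈ Λ` in no usable window. Then `|E₁ F − E₂ F| ≤ Σ_{x ∈ Λ} d x δ x` for every bounded measurable `Λ`-local `F` with
  site-Lipschitz vector `δ`.
* `abs_sub_le_of_window_geometric` — no defects (`E₂` invariant), a profile `ℓ : V → ℕ` such that every window through a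
  site of positive profile is usable and `ℓ` drops by at most one along the support of `K`:
  `|E₁ F − E₂ F| ≤ R Σ_{x ∈ Λ} γ₀^{ℓ x} δ x`; with `δ` supported at profile `≥ L₀`:
  `|E₁ F − E₂ F| ≤ R γ₀^{L₀} Σ_{x ∈ Λ} δ x` (`abs_sub_le_of_window_geometric_exp`) — in place of the tree's
  `2 R e^{−(1−γ₀)² L₀/(2(2γ₀N⋆+1))} Σ δ` (`abs_sub_le_of_window`).

References: H. Föllmer, LNM 1362 (1988), Ch. I, (2.7)–(2.11), Thm. (2.8); R. L. Dobrushin, S. B. Shlosman (1985), Thm. 1;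
the tree files `DobrushinShlosmanSuperSolution.lean`, `DobrushinShlosmanInfiniteVolume.lean`.
-/

noncomputable section

open MeasureTheory ProbabilityTheory Finset Function
open Literature.Probability.LatticeModels.DobrushinMetric (IsLipBound integrable_of_abs_le'
  abs_sub_le_mul_sum_of_dependsOn)

namespace Literature.Probability.LatticeModels.DobrushinShlosman

variable {V S : Type*} [MeasurableSpace S]

/-- Freezing one coordinate to a constant is measurable. [folklore] -/
private theorem measurable_update_const₃ [DecidableEq V] (y : V) (a : S) :
    Measurable fun σ : V → S => Function.update σ y a := by
  refine measurable_pi_iff.2 fun z => ?_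
  by_cases hz : z = y
  · subst hz
    simp only [Function.update_self]
    exact measurable_const
  · simp only [Function.update_of_ne hz]
    exact measurable_pi_apply z

/-- **The window comparison with a super-solution (and defects), infinite volume** (Föllmer 1988 Ch. I
(2.7)–(2.11), Thm. (2.8), in Dobrushin–Shlosman's window setting). See the module docstring for the data; the
PER-WINDOW received sum `Σ_{y ∈ nbhd c} K c y x ≤ γ₀ < 1` replaces the averaged condition, `E₂` is only ALMOST
invariant under the usable window kernels (defect array `κ ≥ 0`), and the conclusion is governed by any nonnegative
super-solution `d`: `|E₁ F − E₂ F| ≤ Σ_{x ∈ Λ} d x δ x`. PROOF: the finite-cell theorem `abs_sub_le_superSolution` on the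
cell type `↥Λ` (genuine centres act by their window kernel with the exterior frozen to `ω`, the others freeze their
own site and are never usable), exactly as in `abs_sub_le_of_window`.
[cite: Follmer1988, Ch. I Theorem (2.8) and Remark (2.11)] -/
theorem abs_sub_le_of_window_superSolution [DecidableEq V] {γ : Specification V S} (hγ : IsSpecification γ)
    {r : S → S → ℝ} {R : ℝ} (hr0 : ∀ a b, 0 ≤ r a b) (hrR : ∀ a b, r a b ≤ R) (hR : 0 ≤ R)
    {win nbhd : V → Finset V} {K : V → V → V → ℝ} (hK0 : ∀ c y x, 0 ≤ K c y x)
    (hwin : ∀ c, win c ⊆ nbhd c)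
    (hKsupp : ∀ c y x, K c y x ≠ 0 → y ∈ nbhd c)
    (hcontract : ∀ (c y : V), y ∉ win c → ∀ (ω η : V → S), (∀ v, v ≠ y → ω v = η v) →
      ∀ (f : (V → S) → ℝ) (δ : V → ℝ), Measurable f → (∃ B, ∀ σ, |f σ| ≤ B) →
        DependsOn f (win c : Set V) → (∀ x, 0 ≤ δ x) →
        (∀ (x : V) (σ τ : V → S), (∀ v, v ≠ x → σ v = τ v) → |f σ - f τ| ≤ δ x * r (σ x) (τ x)) →
          |∫ σ, f σ ∂(γ (win c) ω) - ∫ σ, f σ ∂(γ (win c) η)| ≤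
            (∑ x ∈ win c, K c y x * δ x) * r (ω y) (η y))
    (hloc : ∀ (c : V) (ζ ζ' : V → S), (∀ v ∈ nbhd c, ζ v = ζ' v) →
      ∀ (f : (V → S) → ℝ), Measurable f → (∃ B, ∀ σ, |f σ| ≤ B) → DependsOn f (win c : Set V) →
        ∫ σ, f σ ∂(γ (win c) ζ) = ∫ σ, f σ ∂(γ (win c) ζ'))
    {γ₀ : ℝ} (hγ₀ : 0 ≤ γ₀) (hγ₁ : γ₀ < 1)
    (hsum : ∀ c, ∀ x ∈ win c, ∑ y ∈ nbhd c, K c y x ≤ γ₀)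
    (Λ : Finset V) (ω : V → S) (P : V → Prop) {E₁ E₂ : ((V → S) → ℝ) → ℝ}
    (h₁le : ∀ ⦃G : (V → S) → ℝ⦄ ⦃M : ℝ⦄, Measurable G → (∃ B, ∀ σ, |G σ| ≤ B) →
      DependsOn G (Λ : Set V) → (∀ σ, G σ ≤ M) → E₁ G ≤ M)
    (h₁ge : ∀ ⦃G : (V → S) → ℝ⦄ ⦃M : ℝ⦄, Measurable G → (∃ B, ∀ σ, |G σ| ≤ B) →
      DependsOn G (Λ : Set V) → (∀ σ, M ≤ G σ) → M ≤ E₁ G)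
    (h₁T : ∀ c, c ∈ Λ → nbhd c ⊆ Λ → P c → ∀ ⦃G : (V → S) → ℝ⦄, Measurable G →
      (∃ B, ∀ σ, |G σ| ≤ B) → DependsOn G (Λ : Set V) →
        E₁ (fun σ => ∫ τ, G τ ∂(γ (win c) σ)) = E₁ G)
    (h₂le : ∀ ⦃G : (V → S) → ℝ⦄ ⦃M : ℝ⦄, Measurable G → (∃ B, ∀ σ, |G σ| ≤ B) →
      DependsOn G (Λ : Set V) → (∀ σ, G σ ≤ M) → E₂ G ≤ M)
    (h₂ge : ∀ ⦃G : (V → S) → ℝ⦄ ⦃M : ℝ⦄, Measurable G → (∃ B, ∀ σ, |G σ| ≤ B) →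
      DependsOn G (Λ : Set V) → (∀ σ, M ≤ G σ) → M ≤ E₂ G)
    {κ : V → V → ℝ} (hκ0 : ∀ c x, 0 ≤ κ c x)
    (h₂D : ∀ c, c ∈ Λ → nbhd c ⊆ Λ → P c → ∀ ⦃G : (V → S) → ℝ⦄, Measurable G →
      (∃ B, ∀ σ, |G σ| ≤ B) → DependsOn G (Λ : Set V) → ∀ ⦃δ : V → ℝ⦄, IsLipBound r G δ →
        |E₂ (fun σ => ∫ τ, G τ ∂(γ (win c) σ)) - E₂ G| ≤ ∑ x ∈ win c, κ c x * δ x)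
    {d : V → ℝ} (hd0 : ∀ x, 0 ≤ d x)
    (hdS : ∀ c, c ∈ Λ → nbhd c ⊆ Λ → P c → ∀ x ∈ win c, ∑ y ∈ nbhd c, K c y x * d y + κ c x ≤ d x)
    (hdR : ∀ x ∈ Λ, (∀ c, c ∈ Λ → nbhd c ⊆ Λ → P c → x ∉ win c) → R ≤ d x)
    {F : (V → S) → ℝ} (hFm : Measurable F) {B : ℝ} (hB : ∀ σ, |F σ| ≤ B)
    (hFdep : DependsOn F (Λ : Set V)) {δ : V → ℝ} (hδ : IsLipBound r F δ) :
    |E₁ F - E₂ F| ≤ ∑ x ∈ Λ, d x * δ x := by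
  -- adapted from `DobrushinShlosman.abs_sub_le_of_window` (same reduction to the cell type `↥Λ`)
  classical
  -- extension of a vector on the cell type `↥Λ` by zero
  let ext : (↥Λ → ℝ) → V → ℝ := fun δ' v => if h : v ∈ Λ then δ' ⟨v, h⟩ else 0
  have ext_apply : ∀ (δ' : ↥Λ → ℝ) (x : ↥Λ), ext δ' x.1 = δ' x := fun δ' x => by
    simp only [ext, dif_pos x.2]
  have ext_of_not_mem : ∀ (δ' : ↥Λ → ℝ) {v : V}, v ∉ Λ → ext δ' v = 0 := fun δ' v hv => by
    simp only [ext, dif_neg hv]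
  -- admissible observables, Lipschitz vectors, window operators on `↥Λ`
  set Adm : ((V → S) → ℝ) → Prop := fun G =>
    Measurable G ∧ (∃ B, ∀ σ, |G σ| ≤ B) ∧ DependsOn G (Λ : Set V) with hAdm
  set Lip : ((V → S) → ℝ) → (↥Λ → ℝ) → Prop := fun G δ' => (∀ x, 0 ≤ δ' x) ∧
    ∀ (x : ↥Λ) (σ τ : V → S), (∀ v, v ≠ x.1 → σ v = τ v) → |G σ - G τ| ≤ δ' x * r (σ x.1) (τ x.1)
    with hLip
  -- a Lipschitz vector on `↥Λ` of a `Λ`-local observable is a site-Lipschitz bound on `V`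
  have lipV : ∀ {G : (V → S) → ℝ} {δ' : ↥Λ → ℝ}, Adm G → Lip G δ' → IsLipBound r G (ext δ') := by
    rintro G δ' ⟨-, -, hGdep⟩ ⟨hδ'0, hδ'⟩
    refine ⟨fun v => ?_, fun v σ τ hστ => ?_⟩
    · by_cases hv : v ∈ Λ
      · rw [show ext δ' v = δ' ⟨v, hv⟩ from ext_apply δ' ⟨v, hv⟩]; exact hδ'0 _
      · rw [ext_of_not_mem δ' hv]
    · by_cases hv : v ∈ Λ
      · rw [show ext δ' v = δ' ⟨v, hv⟩ from ext_apply δ' ⟨v, hv⟩]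
        exact hδ' ⟨v, hv⟩ σ τ hστ
      · rw [ext_of_not_mem δ' hv, zero_mul]
        rw [hGdep fun u hu => hστ u fun huv => hv (huv ▸ Finset.mem_coe.1 hu), sub_self, abs_zero]
  set T : ↥Λ → ((V → S) → ℝ) → ((V → S) → ℝ) := fun c G =>
    if nbhd c.1 ⊆ Λ then fun σ => ∫ τ, G τ ∂(γ (win c.1) (Λ.piecewise σ ω))
    else fun σ => G (Function.update σ c.1 (ω c.1)) with hT
  set win' : ↥Λ → Finset ↥Λ := fun c =>
    if nbhd c.1 ⊆ Λ then (win c.1).subtype (· ∈ Λ) else {c} with hwin'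
  set k' : ↥Λ → ↥Λ → ↥Λ → ℝ := fun c y x => if nbhd c.1 ⊆ Λ then K c.1 y.1 x.1 else 0 with hk'
  set κ' : ↥Λ → ↥Λ → ℝ := fun c x => if nbhd c.1 ⊆ Λ then κ c.1 x.1 else 0 with hκ'
  set U : Finset ↥Λ := Finset.univ.filter fun c => nbhd c.1 ⊆ Λ ∧ P c.1 with hUdef
  -- membership in the two kinds of windows
  have mem_win'_gen : ∀ {c x : ↥Λ}, nbhd c.1 ⊆ Λ → (x ∈ win' c ↔ x.1 ∈ win c.1) :=
    fun {c x} hc => by simp only [hwin', if_pos hc, Finset.mem_subtype]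
  have mem_win'_frz : ∀ {c x : ↥Λ}, ¬ nbhd c.1 ⊆ Λ → (x ∈ win' c ↔ x = c) :=
    fun {c x} hc => by simp only [hwin', if_neg hc, Finset.mem_singleton]
  -- (hlip0)
  have hlip0 : ∀ ⦃G : (V → S) → ℝ⦄ ⦃δ' : ↥Λ → ℝ⦄, Lip G δ' → ∀ x, 0 ≤ δ' x := fun G δ' h => h.1
  -- (hosc) interpolation on the sites of `Λ`
  have hoscA : ∀ ⦃G : (V → S) → ℝ⦄ ⦃δ' : ↥Λ → ℝ⦄, Adm G → Lip G δ' →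
      ∀ σ τ, |G σ - G τ| ≤ R * ∑ x, δ' x := by
    intro G δ' hG hδ' σ τ
    have h := abs_sub_le_mul_sum_of_dependsOn hrR hG.2.2 (lipV hG hδ') σ τ
    have hs : ∑ y ∈ Λ, ext δ' y = ∑ x : ↥Λ, δ' x := by
      rw [← Finset.sum_coe_sort]
      exact Finset.sum_congr rfl fun x _ => ext_apply δ' x
    rwa [hs] at h
  -- (hk), (hκ)
  have hk : ∀ c y x, 0 ≤ k' c y x := fun c y x => by
    simp only [hk']; split_ifs; exacts [hK0 _ _ _, le_rfl]
  have hκ'0 : ∀ c x, 0 ≤ κ' c x := fun c x => by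
    simp only [hκ']; split_ifs; exacts [hκ0 _ _, le_rfl]
  -- (hT) the window operators preserve admissibility
  have hTA : ∀ ⦃G : (V → S) → ℝ⦄ (c : ↥Λ), Adm G → Adm (T c G) := by
    rintro G c ⟨hGm, ⟨B', hB'⟩, hGdep⟩
    by_cases hc : nbhd c.1 ⊆ Λ
    · simp only [hT, if_pos hc]
      refine ⟨(measurable_windowAvg' hγ (win c.1) hGm).comp (measurable_piecewise_conf Λ ω),
        ⟨B', fun σ => abs_windowAvg_le' hγ (win c.1) hB' _⟩, fun σ σ' hσ => ?_⟩
      have : Λ.piecewise σ ω = Λ.piecewise σ' ω := by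
        funext v
        by_cases hv : v ∈ Λ
        · rw [Finset.piecewise_eq_of_mem _ _ _ hv, Finset.piecewise_eq_of_mem _ _ _ hv]
          exact hσ v (Finset.mem_coe.2 hv)
        · rw [Finset.piecewise_eq_of_notMem _ _ _ hv, Finset.piecewise_eq_of_notMem _ _ _ hv]
      simp only [this]
    · simp only [hT, if_neg hc]
      refine ⟨hGm.comp (measurable_update_const₃ c.1 (ω c.1)), ⟨B', fun σ => hB' _⟩,
        fun σ σ' hσ => hGdep fun v hv => ?_⟩
      by_cases hvc : v = c.1
      · subst hvc; simp
      · rw [Function.update_of_ne hvc, Function.update_of_ne hvc]; exact hσ v hv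
  -- (hdust) the window dusting estimate
  have hdust : ∀ ⦃G : (V → S) → ℝ⦄ ⦃δ' : ↥Λ → ℝ⦄ (c : ↥Λ), Adm G → Lip G δ' →
      Lip (T c G) fun y => if y ∈ win' c then 0 else δ' y + ∑ x ∈ win' c, k' c y x * δ' x := by
    intro G δ' c hG hδ'
    have hGV := lipV hG hδ'
    obtain ⟨hGm, ⟨B', hB'⟩, hGdep⟩ := hG
    refine ⟨fun y => ?_, fun y σ τ hστ => ?_⟩
    · dsimp only
      split_ifs
      · exact le_rfl
      · exact add_nonneg (hδ'.1 y) (Finset.sum_nonneg fun x _ => mul_nonneg (hk c y x) (hδ'.1 x))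
    by_cases hc : nbhd c.1 ⊆ Λ
    · -- a genuine window: the tree's window dusting estimate with the exterior frozen to `ω`
      have hwinΛ : win c.1 ⊆ Λ := (hwin c.1).trans hc
      have hωη : ∀ v, id v ≠ y.1 → Λ.piecewise σ ω v = Λ.piecewise τ ω v := fun v hv => by
        by_cases hvΛ : v ∈ Λ
        · rw [Finset.piecewise_eq_of_mem _ _ _ hvΛ, Finset.piecewise_eq_of_mem _ _ _ hvΛ]
          exact hστ v hv
        · rw [Finset.piecewise_eq_of_notMem _ _ _ hvΛ, Finset.piecewise_eq_of_notMem _ _ _ hvΛ]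
      have key := lip_windowAvg (ι := V) (cell := id) (w := fun x σ τ => r (σ x) (τ x)) hγ
        (fun x σ σ' τ τ' hσ hτ => by simp only [hσ x rfl, hτ x rfl])
        (Λ := win c.1) (W := win c.1) (fun v => Iff.rfl) (kc := K c.1) (hcontract c.1) hGm hB'
        hGV.nonneg hGV.le y.1 (Λ.piecewise σ ω) (Λ.piecewise τ ω) hωη
      have hry : r (Λ.piecewise σ ω y.1) (Λ.piecewise τ ω y.1) = r (σ y.1) (τ y.1) := by
        rw [Finset.piecewise_eq_of_mem _ _ _ y.2, Finset.piecewise_eq_of_mem _ _ _ y.2]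
      have hsumeq : ∑ x ∈ win c.1, K c.1 y.1 x * ext δ' x = ∑ x ∈ win' c, k' c y x * δ' x := by
        simp only [hwin', hk', if_pos hc]
        rw [← Finset.sum_subtype_of_mem (f := fun x => K c.1 y.1 x * ext δ' x) fun x hx => hwinΛ hx]
        exact Finset.sum_congr rfl fun x _ => by rw [ext_apply]
      have hmem : (y.1 ∈ win c.1) ↔ (y ∈ win' c) := (mem_win'_gen hc).symm
      simp only [hT, if_pos hc]
      rw [hry, hsumeq, ext_apply] at key
      simp only [hmem] at key
      exact key
    · -- a frozen centre: the operator freezes the site `c`, its window is `{c}`, its array is `0`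
      simp only [hT, if_neg hc]
      by_cases hyc : y = c
      · subst hyc
        have : Function.update σ y.1 (ω y.1) = Function.update τ y.1 (ω y.1) := by
          funext v
          by_cases hv : v = y.1
          · subst hv; simp
          · rw [Function.update_of_ne hv, Function.update_of_ne hv]; exact hστ v hv
        rw [this, sub_self, abs_zero]
        exact mul_nonneg (by
          split_ifs
          · exact le_rfl
          · exact add_nonneg (hδ'.1 y)
              (Finset.sum_nonneg fun x _ => mul_nonneg (hk y y x) (hδ'.1 x))) (hr0 _ _)
      · have hy1 : y.1 ≠ c.1 := fun h => hyc (Subtype.ext h)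
        have h := hδ'.2 y (Function.update σ c.1 (ω c.1)) (Function.update τ c.1 (ω c.1))
          fun v hv => by
            by_cases hvc : v = c.1
            · subst hvc; simp
            · rw [Function.update_of_ne hvc, Function.update_of_ne hvc]; exact hστ v hv
        rw [Function.update_of_ne hy1, Function.update_of_ne hy1] at h
        refine h.trans (mul_le_mul_of_nonneg_right ?_ (hr0 _ _))
        rw [if_neg (fun h' => hyc ((mem_win'_frz hc).1 h'))]
        simp only [hk', if_neg hc, zero_mul, Finset.sum_const_zero, add_zero, le_refl]
  -- a genuine window operator IS the window kernel on admissible observables (locality)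
  have hTgen : ∀ ⦃G : (V → S) → ℝ⦄ (c : ↥Λ), nbhd c.1 ⊆ Λ → Adm G →
      ∀ σ, T c G σ = ∫ τ, G τ ∂(γ (win c.1) σ) := by
    rintro G c hc ⟨hGm, ⟨B', hB'⟩, hGdep⟩ σ
    simp only [hT, if_pos hc]
    exact windowAvg_congr_of_local hγ hc (hloc c.1) hGm hB' hGdep fun v hv =>
      Finset.piecewise_eq_of_mem _ _ _ hv
  have hTfun : ∀ ⦃G : (V → S) → ℝ⦄ (c : ↥Λ), nbhd c.1 ⊆ Λ → Adm G →
      T c G = fun σ => ∫ τ, G τ ∂(γ (win c.1) σ) := fun G c hc hG => funext (hTgen c hc hG)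
  -- `E₁` is invariant, `E₂` almost invariant under the usable window operators
  have hinv₁ : ∀ ⦃G : (V → S) → ℝ⦄ (c : ↥Λ), c ∈ U → Adm G → E₁ (T c G) = E₁ G := by
    intro G c hc hG
    obtain ⟨hc₁, hc₂⟩ := (Finset.mem_filter.1 hc).2
    rw [hTfun c hc₁ hG]
    exact h₁T c.1 c.2 hc₁ hc₂ hG.1 hG.2.1 hG.2.2
  have hdef₂ : ∀ ⦃G : (V → S) → ℝ⦄ ⦃δ' : ↥Λ → ℝ⦄ (c : ↥Λ), c ∈ U → Adm G → Lip G δ' →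
      |E₂ (T c G) - E₂ G| ≤ ∑ x ∈ win' c, κ' c x * δ' x := by
    intro G δ' c hc hG hδ'
    obtain ⟨hc₁, hc₂⟩ := (Finset.mem_filter.1 hc).2
    have hGV := lipV hG hδ'
    rw [hTfun c hc₁ hG]
    have key := h₂D c.1 c.2 hc₁ hc₂ hG.1 hG.2.1 hG.2.2 hGV
    have hwinΛ : win c.1 ⊆ Λ := (hwin c.1).trans hc₁
    have hsumeq : ∑ x ∈ win c.1, κ c.1 x * ext δ' x = ∑ x ∈ win' c, κ' c x * δ' x := by
      simp only [hwin', hκ', if_pos hc₁]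
      rw [← Finset.sum_subtype_of_mem (f := fun x => κ c.1 x * ext δ' x) fun x hx => hwinΛ hx]
      exact Finset.sum_congr rfl fun x _ => by rw [ext_apply]
    rwa [hsumeq] at key
  -- monotone normalisation on admissible observables
  have hle₁ : ∀ ⦃G : (V → S) → ℝ⦄ ⦃M : ℝ⦄, Adm G → (∀ σ, G σ ≤ M) → E₁ G ≤ M :=
    fun G M hG hM => h₁le hG.1 hG.2.1 hG.2.2 hM
  have hge₁ : ∀ ⦃G : (V → S) → ℝ⦄ ⦃M : ℝ⦄, Adm G → (∀ σ, M ≤ G σ) → M ≤ E₁ G :=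
    fun G M hG hM => h₁ge hG.1 hG.2.1 hG.2.2 hM
  have hle₂ : ∀ ⦃G : (V → S) → ℝ⦄ ⦃M : ℝ⦄, Adm G → (∀ σ, G σ ≤ M) → E₂ G ≤ M :=
    fun G M hG hM => h₂le hG.1 hG.2.1 hG.2.2 hM
  have hge₂ : ∀ ⦃G : (V → S) → ℝ⦄ ⦃M : ℝ⦄, Adm G → (∀ σ, M ≤ G σ) → M ≤ E₂ G :=
    fun G M hG hM => h₂ge hG.1 hG.2.1 hG.2.2 hM
  -- (hsumw) per-window received sums on `↥Λ`
  have hsumι : ∀ c ∈ U, ∀ x ∈ win' c, ∑ y, k' c y x ≤ γ₀ := by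
    intro c hc x hxc
    obtain ⟨hgen, -⟩ := (Finset.mem_filter.1 hc).2
    simp only [hk', if_pos hgen]
    have h1 : ∑ y : ↥Λ, K c.1 y.1 x.1 = ∑ y ∈ Λ, K c.1 y x.1 := Finset.sum_coe_sort Λ (fun y => K c.1 y x.1)
    have h2 : ∑ y ∈ Λ, K c.1 y x.1 = ∑ y ∈ nbhd c.1, K c.1 y x.1 := by
      refine (Finset.sum_subset hgen fun y _ hy => ?_).symm
      by_contra h
      exact hy (hKsupp _ _ _ h)
    rw [h1, h2]
    exact hsum c.1 x.1 ((mem_win'_gen hgen).1 hxc)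
  -- the super-solution on `↥Λ`
  have hdSι : ∀ c ∈ U, ∀ x ∈ win' c, ∑ y, k' c y x * (fun y : ↥Λ => d y.1) y + κ' c x ≤ d x.1 := by
    intro c hc x hxc
    obtain ⟨hgen, hPc⟩ := (Finset.mem_filter.1 hc).2
    simp only [hk', hκ', if_pos hgen]
    have h1 : ∑ y : ↥Λ, K c.1 y.1 x.1 * d y.1 = ∑ y ∈ Λ, K c.1 y x.1 * d y :=
      Finset.sum_coe_sort Λ (fun y => K c.1 y x.1 * d y)
    have h2 : ∑ y ∈ Λ, K c.1 y x.1 * d y = ∑ y ∈ nbhd c.1, K c.1 y x.1 * d y := by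
      refine (Finset.sum_subset hgen fun y _ hy => ?_).symm
      by_cases h : K c.1 y x.1 = 0
      · rw [h, zero_mul]
      · exact absurd (hKsupp _ _ _ h) hy
    rw [h1, h2]
    exact hdS c.1 c.2 hgen hPc x.1 ((mem_win'_gen hgen).1 hxc)
  have hdRι : ∀ x : ↥Λ, (∀ c ∈ U, x ∉ win' c) → R ≤ d x.1 := by
    intro x hx
    refine hdR x.1 x.2 fun c hcΛ hcn hPc hxc => ?_
    have hcU : (⟨c, hcΛ⟩ : ↥Λ) ∈ U := Finset.mem_filter.2 ⟨Finset.mem_univ _, hcn, hPc⟩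
    exact hx ⟨c, hcΛ⟩ hcU ((mem_win'_gen (c := ⟨c, hcΛ⟩) hcn).2 hxc)
  -- the data of `F`
  have hFA : Adm F := ⟨hFm, ⟨B, hB⟩, hFdep⟩
  have hδι : Lip F fun x : ↥Λ => δ x.1 :=
    ⟨fun x => hδ.nonneg x.1, fun x σ τ hστ => hδ.le x.1 σ τ hστ⟩
  -- the finite-cell super-solution theorem
  have key := abs_sub_le_superSolution (ι := ↥Λ) (Ω := V → S) (Adm := Adm) (Lip := Lip) (T := T)
    (win := win') (k := k') (κ := κ') (U := U) (E₁ := E₁) (E₂ := E₂) hR hlip0 hoscA hk hκ'0 hTA hdust hle₁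
    hge₁ hinv₁ hle₂ hge₂ hdef₂ hγ₀ hγ₁ hsumι (d := fun x : ↥Λ => d x.1) (fun x => hd0 x.1) hdSι hdRι hFA hδι
  have hs : ∑ x : ↥Λ, d x.1 * δ x.1 = ∑ x ∈ Λ, d x * δ x := Finset.sum_coe_sort Λ (fun x => d x * δ x)
  rw [hs] at key
  exact key

/-- **GEOMETRIC DECAY ALONG A PROFILE, infinite volume** (no defects). Window data and per-window received sum as in
`abs_sub_le_of_window_superSolution`; `E₁, E₂` monotone-normalised and invariant under the usable window kernels;
a profile `ℓ : V → ℕ` such that every window through a site of positive profile is usable (`c ∈ Λ`, `nbhd c ⊆ Λ`,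
`P c`) and `ℓ` drops by at most one along the support of `K`. Then for a bounded measurable `Λ`-local `F` with
site-Lipschitz vector `δ`: `|E₁ F − E₂ F| ≤ R Σ_{x ∈ Λ} γ₀^{ℓ x} δ x` (the super-solution `R γ₀^{ℓ}`).
[cite: Follmer1988, Ch. I Theorem (2.8) and Remark (2.11)] -/
theorem abs_sub_le_of_window_geometric [DecidableEq V] {γ : Specification V S} (hγ : IsSpecification γ)
    {r : S → S → ℝ} {R : ℝ} (hr0 : ∀ a b, 0 ≤ r a b) (hrR : ∀ a b, r a b ≤ R) (hR : 0 ≤ R)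
    {win nbhd : V → Finset V} {K : V → V → V → ℝ} (hK0 : ∀ c y x, 0 ≤ K c y x)
    (hself : ∀ c, c ∈ win c) (hwin : ∀ c, win c ⊆ nbhd c)
    (hKsupp : ∀ c y x, K c y x ≠ 0 → y ∈ nbhd c)
    (hcontract : ∀ (c y : V), y ∉ win c → ∀ (ω η : V → S), (∀ v, v ≠ y → ω v = η v) →
      ∀ (f : (V → S) → ℝ) (δ : V → ℝ), Measurable f → (∃ B, ∀ σ, |f σ| ≤ B) →
        DependsOn f (win c : Set V) → (∀ x, 0 ≤ δ x) →
        (∀ (x : V) (σ τ : V → S), (∀ v, v ≠ x → σ v = τ v) → |f σ - f τ| ≤ δ x * r (σ x) (τ x)) →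
          |∫ σ, f σ ∂(γ (win c) ω) - ∫ σ, f σ ∂(γ (win c) η)| ≤
            (∑ x ∈ win c, K c y x * δ x) * r (ω y) (η y))
    (hloc : ∀ (c : V) (ζ ζ' : V → S), (∀ v ∈ nbhd c, ζ v = ζ' v) →
      ∀ (f : (V → S) → ℝ), Measurable f → (∃ B, ∀ σ, |f σ| ≤ B) → DependsOn f (win c : Set V) →
        ∫ σ, f σ ∂(γ (win c) ζ) = ∫ σ, f σ ∂(γ (win c) ζ'))
    {γ₀ : ℝ} (hγ₀ : 0 ≤ γ₀) (hγ₁ : γ₀ < 1)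
    (hsum : ∀ c, ∀ x ∈ win c, ∑ y ∈ nbhd c, K c y x ≤ γ₀)
    (Λ : Finset V) (ω : V → S) (P : V → Prop) {E₁ E₂ : ((V → S) → ℝ) → ℝ}
    (h₁le : ∀ ⦃G : (V → S) → ℝ⦄ ⦃M : ℝ⦄, Measurable G → (∃ B, ∀ σ, |G σ| ≤ B) →
      DependsOn G (Λ : Set V) → (∀ σ, G σ ≤ M) → E₁ G ≤ M)
    (h₁ge : ∀ ⦃G : (V → S) → ℝ⦄ ⦃M : ℝ⦄, Measurable G → (∃ B, ∀ σ, |G σ| ≤ B) →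
      DependsOn G (Λ : Set V) → (∀ σ, M ≤ G σ) → M ≤ E₁ G)
    (h₁T : ∀ c, c ∈ Λ → nbhd c ⊆ Λ → P c → ∀ ⦃G : (V → S) → ℝ⦄, Measurable G →
      (∃ B, ∀ σ, |G σ| ≤ B) → DependsOn G (Λ : Set V) →
        E₁ (fun σ => ∫ τ, G τ ∂(γ (win c) σ)) = E₁ G)
    (h₂le : ∀ ⦃G : (V → S) → ℝ⦄ ⦃M : ℝ⦄, Measurable G → (∃ B, ∀ σ, |G σ| ≤ B) →
      DependsOn G (Λ : Set V) → (∀ σ, G σ ≤ M) → E₂ G ≤ M)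
    (h₂ge : ∀ ⦃G : (V → S) → ℝ⦄ ⦃M : ℝ⦄, Measurable G → (∃ B, ∀ σ, |G σ| ≤ B) →
      DependsOn G (Λ : Set V) → (∀ σ, M ≤ G σ) → M ≤ E₂ G)
    (h₂T : ∀ c, c ∈ Λ → nbhd c ⊆ Λ → P c → ∀ ⦃G : (V → S) → ℝ⦄, Measurable G →
      (∃ B, ∀ σ, |G σ| ≤ B) → DependsOn G (Λ : Set V) →
        E₂ (fun σ => ∫ τ, G τ ∂(γ (win c) σ)) = E₂ G)
    (ℓ : V → ℕ) (hU : ∀ x, ℓ x ≠ 0 → ∀ c, x ∈ win c → c ∈ Λ ∧ nbhd c ⊆ Λ ∧ P c)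
    (hℓ : ∀ c x y, x ∈ win c → K c y x ≠ 0 → ℓ x ≤ ℓ y + 1)
    {F : (V → S) → ℝ} (hFm : Measurable F) {B : ℝ} (hB : ∀ σ, |F σ| ≤ B)
    (hFdep : DependsOn F (Λ : Set V)) {δ : V → ℝ} (hδ : IsLipBound r F δ) :
    |E₁ F - E₂ F| ≤ R * ∑ x ∈ Λ, γ₀ ^ ℓ x * δ x := by
  have key := abs_sub_le_of_window_superSolution hγ hr0 hrR hR hK0 hwin hKsupp hcontract hloc hγ₀ hγ₁ hsum Λ ω P
    h₁le h₁ge h₁T h₂le h₂ge (κ := fun _ _ => 0) (fun _ _ => le_rfl)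
    (fun c hc hn hP G hGm hGb hGdep δ' hδ' => by
      rw [h₂T c hc hn hP hGm hGb hGdep, sub_self, abs_zero]
      exact Finset.sum_nonneg fun x _ => mul_nonneg le_rfl (hδ'.nonneg x))
    (d := fun x => R * γ₀ ^ ℓ x) (fun x => mul_nonneg hR (pow_nonneg hγ₀ _)) ?_ ?_ hFm hB hFdep hδ
  · rw [Finset.mul_sum]
    refine key.trans (le_of_eq (Finset.sum_congr rfl fun x _ => by ring))
  · -- (S1): along a usable window the profile drops by at most one
    intro c _ _ _ x hxc
    rw [add_zero]
    have hterm : ∀ y, K c y x * (R * γ₀ ^ ℓ y) ≤ K c y x * (R * γ₀ ^ (ℓ x - 1)) := fun y => by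
      by_cases hk0 : K c y x = 0
      · rw [hk0, zero_mul, zero_mul]
      · refine mul_le_mul_of_nonneg_left (mul_le_mul_of_nonneg_left ?_ hR) (hK0 c y x)
        exact pow_le_pow_of_le_one hγ₀ hγ₁.le (by have := hℓ c x y hxc hk0; omega)
    calc ∑ y ∈ nbhd c, K c y x * (R * γ₀ ^ ℓ y) ≤ ∑ y ∈ nbhd c, K c y x * (R * γ₀ ^ (ℓ x - 1)) :=
          Finset.sum_le_sum fun y _ => hterm y
      _ = (∑ y ∈ nbhd c, K c y x) * (R * γ₀ ^ (ℓ x - 1)) := by rw [Finset.sum_mul]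
      _ ≤ γ₀ * (R * γ₀ ^ (ℓ x - 1)) := mul_le_mul_of_nonneg_right (hsum c x hxc) (by positivity)
      _ ≤ R * γ₀ ^ ℓ x := by
          rcases Nat.eq_zero_or_pos (ℓ x) with h0 | hpos
          · rw [h0]; simp only [Nat.zero_sub, pow_zero, mul_one]; nlinarith
          · have : γ₀ * γ₀ ^ (ℓ x - 1) = γ₀ ^ ℓ x := by
              rw [← pow_succ']; congr 1; omega
            rw [← mul_assoc, mul_comm γ₀ R, mul_assoc, this]
  · -- (S2): a site of `Λ` in no usable window has profile `0`
    intro x _ hx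
    have hx0 : ℓ x = 0 := by
      by_contra h
      obtain ⟨hcΛ, hcn, hPc⟩ := hU x h x (hself x)
      exact hx x hcΛ hcn hPc (hself x)
    rw [hx0, pow_zero, mul_one]

/-- **Exponential form**: if moreover `δ` vanishes at the sites of profile `< L₀`, then
`|E₁ F − E₂ F| ≤ R γ₀^{L₀} Σ_{x ∈ Λ} δ x` — in place of `2 R e^{−(1−γ₀)² L₀/(2(2γ₀N⋆+1))} Σ δ` of `abs_sub_le_of_window`.
[cite: Follmer1988, Ch. I Theorem (2.8) and Remark (2.11)] -/
theorem abs_sub_le_of_window_geometric_exp [DecidableEq V] {γ : Specification V S} (hγ : IsSpecification γ)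
    {r : S → S → ℝ} {R : ℝ} (hr0 : ∀ a b, 0 ≤ r a b) (hrR : ∀ a b, r a b ≤ R) (hR : 0 ≤ R)
    {win nbhd : V → Finset V} {K : V → V → V → ℝ} (hK0 : ∀ c y x, 0 ≤ K c y x)
    (hself : ∀ c, c ∈ win c) (hwin : ∀ c, win c ⊆ nbhd c)
    (hKsupp : ∀ c y x, K c y x ≠ 0 → y ∈ nbhd c)
    (hcontract : ∀ (c y : V), y ∉ win c → ∀ (ω η : V → S), (∀ v, v ≠ y → ω v = η v) →
      ∀ (f : (V → S) → ℝ) (δ : V → ℝ), Measurable f → (∃ B, ∀ σ, |f σ| ≤ B) →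
        DependsOn f (win c : Set V) → (∀ x, 0 ≤ δ x) →
        (∀ (x : V) (σ τ : V → S), (∀ v, v ≠ x → σ v = τ v) → |f σ - f τ| ≤ δ x * r (σ x) (τ x)) →
          |∫ σ, f σ ∂(γ (win c) ω) - ∫ σ, f σ ∂(γ (win c) η)| ≤
            (∑ x ∈ win c, K c y x * δ x) * r (ω y) (η y))
    (hloc : ∀ (c : V) (ζ ζ' : V → S), (∀ v ∈ nbhd c, ζ v = ζ' v) →
      ∀ (f : (V → S) → ℝ), Measurable f → (∃ B, ∀ σ, |f σ| ≤ B) → DependsOn f (win c : Set V) →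
        ∫ σ, f σ ∂(γ (win c) ζ) = ∫ σ, f σ ∂(γ (win c) ζ'))
    {γ₀ : ℝ} (hγ₀ : 0 ≤ γ₀) (hγ₁ : γ₀ < 1)
    (hsum : ∀ c, ∀ x ∈ win c, ∑ y ∈ nbhd c, K c y x ≤ γ₀)
    (Λ : Finset V) (ω : V → S) (P : V → Prop) {E₁ E₂ : ((V → S) → ℝ) → ℝ}
    (h₁le : ∀ ⦃G : (V → S) → ℝ⦄ ⦃M : ℝ⦄, Measurable G → (∃ B, ∀ σ, |G σ| ≤ B) →
      DependsOn G (Λ : Set V) → (∀ σ, G σ ≤ M) → E₁ G ≤ M)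
    (h₁ge : ∀ ⦃G : (V → S) → ℝ⦄ ⦃M : ℝ⦄, Measurable G → (∃ B, ∀ σ, |G σ| ≤ B) →
      DependsOn G (Λ : Set V) → (∀ σ, M ≤ G σ) → M ≤ E₁ G)
    (h₁T : ∀ c, c ∈ Λ → nbhd c ⊆ Λ → P c → ∀ ⦃G : (V → S) → ℝ⦄, Measurable G →
      (∃ B, ∀ σ, |G σ| ≤ B) → DependsOn G (Λ : Set V) →
        E₁ (fun σ => ∫ τ, G τ ∂(γ (win c) σ)) = E₁ G)
    (h₂le : ∀ ⦃G : (V → S) → ℝ⦄ ⦃M : ℝ⦄, Measurable G → (∃ B, ∀ σ, |G σ| ≤ B) →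
      DependsOn G (Λ : Set V) → (∀ σ, G σ ≤ M) → E₂ G ≤ M)
    (h₂ge : ∀ ⦃G : (V → S) → ℝ⦄ ⦃M : ℝ⦄, Measurable G → (∃ B, ∀ σ, |G σ| ≤ B) →
      DependsOn G (Λ : Set V) → (∀ σ, M ≤ G σ) → M ≤ E₂ G)
    (h₂T : ∀ c, c ∈ Λ → nbhd c ⊆ Λ → P c → ∀ ⦃G : (V → S) → ℝ⦄, Measurable G →
      (∃ B, ∀ σ, |G σ| ≤ B) → DependsOn G (Λ : Set V) →
        E₂ (fun σ => ∫ τ, G τ ∂(γ (win c) σ)) = E₂ G)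
    (ℓ : V → ℕ) (L₀ : ℕ) (hU : ∀ x, ℓ x ≠ 0 → ∀ c, x ∈ win c → c ∈ Λ ∧ nbhd c ⊆ Λ ∧ P c)
    (hℓ : ∀ c x y, x ∈ win c → K c y x ≠ 0 → ℓ x ≤ ℓ y + 1)
    {F : (V → S) → ℝ} (hFm : Measurable F) {B : ℝ} (hB : ∀ σ, |F σ| ≤ B)
    (hFdep : DependsOn F (Λ : Set V)) {δ : V → ℝ} (hδ : IsLipBound r F δ)
    (hδL : ∀ x, ℓ x < L₀ → δ x = 0) :
    |E₁ F - E₂ F| ≤ R * γ₀ ^ L₀ * ∑ x ∈ Λ, δ x := by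
  have key := abs_sub_le_of_window_geometric hγ hr0 hrR hR hK0 hself hwin hKsupp hcontract hloc hγ₀ hγ₁ hsum Λ ω P
    h₁le h₁ge h₁T h₂le h₂ge h₂T ℓ hU hℓ hFm hB hFdep hδ
  refine key.trans ?_
  rw [mul_assoc, Finset.mul_sum Λ (fun x => δ x) (γ₀ ^ L₀)]
  refine mul_le_mul_of_nonneg_left (Finset.sum_le_sum fun x _ => ?_) hR
  by_cases hx : ℓ x < L₀
  · rw [hδL x hx, mul_zero, mul_zero]
  · exact mul_le_mul_of_nonneg_right (pow_le_pow_of_le_one hγ₀ hγ₁.le (not_lt.1 hx)) (hδ.nonneg x)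

end Literature.Probability.LatticeModels.DobrushinShlosman

end
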